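import Summits.CriticalPhenomena.CardyFormulaZ2.Theorems.CardyRotToConfR2SymmetryUpgrade.Negative.SurgCrosscutDomain
import HarnessLib

/-!
# Nested crosscut domains with a common crosscut
# (line `germ-label-transport`, crux `stmt-CriticalPhenomena-0698`, stub `stub_fatSurgeryLocal`)

Geometric half of the restriction-form locality of the fat-germ one-shot surgery
(`Negative.fatSurgery`). Setting: Dobrushin domains `D' ⊆ D` with the same target `b`, and ONE set `L`
which is a crosscut of both (in the application: the common surgery chord of two domains agreeing
near `a`), landing at `q ≠ b`. Write `D ∖ L = E ⊔ W`, `D' ∖ L = E' ⊔ W'` for the `b`-adjacent and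
the other components (`Negative.bComponent`, `Negative.otherComponent`). Then:

* `closure_bComponent_inter_closure_otherComponent` — `closure E ∩ closure W ⊆ L` (one domain: a
  common point off `E ∪ W` is on both frontiers `L ∪ bArc`, `L ∪ otherArc`, and the two boundary
  arcs meet only at the endpoints `a, q ∈ L`);
* `bComponent_subset_bComponent` — `E' ⊆ E` (`E'` is connected inside `E ⊔ W` and accumulates at
  `b ∉ closure W`);
* `otherComponent_subset_otherComponent` — `W' ⊆ W` (else `D' ∖ L ⊆ E`; but `W` accumulates at an
  inner point `p ∈ L ∩ D'`, and points of `W` near `p` are in `D' ∖ L ⊆ E`, absurd);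
* `bComponent_inter_subset`, `bComponent_diff_subset` — `E ∩ D' ⊆ E'`, so `E ∖ E' ⊆ D ∖ D'`;
* `closure_diff_inter_closure_subset` — if the points of `L` inside `D` are in `D'`, then
  `closure (D ∖ D') ∩ closure E ⊆ closure (E ∖ E') ∪ L` (since `D ∖ D' ⊆ (E ∖ E') ∪ W`);
* `stub_fatSurgeryLocalGeom` — the three facts used by the locality proof, bundled (registered
  helper sub-goal of `stub_fatSurgeryLocal`).

References: M. H. A. Newman, *Elements of the topology of plane sets of points* (1939), Ch. V §11
(cross-cuts); G. Lawler, O. Schramm, W. Werner, *Values of Brownian intersection exponents I*,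
Acta Math. 187 (2001), Cor. 2.4 (restriction form of locality).
-/

noncomputable section

open Set Filter Topology Metric

namespace Summit.CriticalPhenomena.CardyFormulaZ2.Theorems.CardyRotToConfR2SymmetryUpgrade

open Literature.Probability.RandomPlanarGeometry Literature.Topology.PlaneTopology
open Summit.CriticalPhenomena.CardyFormulaZ2.Theorems.CardyRotToConfR2SymmetryUpgrade.Negative

namespace FatSurgeryLocal

/-! ### One domain: the two components of `D ∖ L` touch only along `L` -/

/-- A crosscut has a point other than its endpoints (hence inside the domain). [folklore] -/
theorem exists_mem_crosscut_mem_carrier {D : DobrushinDomain} {L : Set ℂ} {q : ℂ}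
    (hL : D.IsCrosscut L (D.pt 0) q) : ∃ p ∈ L, p ∈ D.carrier := by
  obtain ⟨γ, -, hγi, hγL, hγ0, hγ1⟩ := hL.1
  have hhalf : (1 / 2 : ℝ) ∈ Icc (0 : ℝ) 1 := ⟨by norm_num, by norm_num⟩
  have hp : γ (1 / 2) ∈ L := hγL ▸ mem_image_of_mem γ hhalf
  refine ⟨γ (1 / 2), hp, hL.2.2.2.2 ⟨hp, ?_⟩⟩
  rintro (h0 | h1)
  · have := hγi hhalf (left_mem_Icc.2 zero_le_one) (h0.trans hγ0.symm)
    norm_num at this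
  · have := hγi hhalf (right_mem_Icc.2 zero_le_one) ((mem_singleton_iff.1 h1).trans hγ1.symm)
    norm_num at this

section OneDomain

variable {D : DobrushinDomain} {L : Set ℂ} {q : ℂ} (hL : D.IsCrosscut L (D.pt 0) q) (hqb : q ≠ D.pt 1)
include hL hqb

/-- **The closures of the two components of `D ∖ L` meet only on the crosscut.** [folklore] -/
theorem closure_bComponent_inter_closure_otherComponent :
    closure (bComponent hL hqb) ∩ closure (otherComponent hL hqb) ⊆ L := by
  rintro x ⟨hxE, hxW⟩
  have hdisj := disjoint_components hL hqb
  have hxE' : x ∉ bComponent hL hqb := fun hx =>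
    Set.disjoint_left.1 (hdisj.symm.closure_left (isOpen_bComponent hL hqb)) hxW hx
  have hxW' : x ∉ otherComponent hL hqb := fun hx =>
    Set.disjoint_left.1 (hdisj.closure_left (isOpen_otherComponent hL hqb)) hxE hx
  have hfrE : x ∈ frontier (bComponent hL hqb) := by
    rw [(isOpen_bComponent hL hqb).frontier_eq]
    exact ⟨hxE, hxE'⟩
  have hfrW : x ∈ frontier (otherComponent hL hqb) := by
    rw [(isOpen_otherComponent hL hqb).frontier_eq]
    exact ⟨hxW, hxW'⟩
  rw [frontier_bComponent] at hfrE
  rw [frontier_otherComponent] at hfrW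
  rcases hfrE with h | hA
  · exact h
  rcases hfrW with h | hA'
  · exact h
  rcases bArc_inter_otherArc hL hqb ⟨hA, hA'⟩ with h | h
  · rw [h]; exact hL.1.left_mem
  · rw [mem_singleton_iff.1 h]; exact hL.1.right_mem

end OneDomain

/-! ### Two nested domains with a common crosscut -/

section TwoDomains

variable {D D' : DobrushinDomain} {L L' : Set ℂ} {q q' : ℂ}
  (hL : D.IsCrosscut L (D.pt 0) q) (hqb : q ≠ D.pt 1)
  (hL' : D'.IsCrosscut L' (D'.pt 0) q') (hqb' : q' ≠ D'.pt 1)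

/-- **The `b`-components are nested**: `E' ⊆ E`. [folklore] -/
theorem bComponent_subset_bComponent (hsub : D'.carrier ⊆ D.carrier) (h1 : D'.pt 1 = D.pt 1)
    (hLL' : L' = L) : bComponent hL' hqb' ⊆ bComponent hL hqb := by
  have hsub' : bComponent hL' hqb' ⊆ bComponent hL hqb ∪ otherComponent hL hqb := by
    rw [union_components]
    intro x hx
    have := bComponent_subset hL' hqb' hx
    rw [hLL'] at this
    exact ⟨hsub this.1, this.2⟩
  rcases (isConnected_bComponent hL' hqb').isPreconnected.subset_or_subset (isOpen_bComponent hL hqb)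
    (isOpen_otherComponent hL hqb) (disjoint_components hL hqb) hsub' with h | h
  · exact h
  · exfalso
    have hb : D'.pt 1 ∈ closure (otherComponent hL hqb) :=
      closure_mono h (frontier_subset_closure (pt_one_mem_frontier_bComponent hL' hqb'))
    rw [h1] at hb
    exact pt_one_notMem_closure_otherComponent hL hqb hb

/-- **The other components are nested**: `W' ⊆ W`. [folklore] -/
theorem otherComponent_subset_otherComponent (hsub : D'.carrier ⊆ D.carrier) (h1 : D'.pt 1 = D.pt 1)
    (hLL' : L' = L) : otherComponent hL' hqb' ⊆ otherComponent hL hqb := by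
  have hsub' : otherComponent hL' hqb' ⊆ bComponent hL hqb ∪ otherComponent hL hqb := by
    rw [union_components]
    intro x hx
    have := otherComponent_subset hL' hqb' hx
    rw [hLL'] at this
    exact ⟨hsub this.1, this.2⟩
  rcases (isConnected_otherComponent hL' hqb').isPreconnected.subset_or_subset
    (isOpen_bComponent hL hqb) (isOpen_otherComponent hL hqb) (disjoint_components hL hqb) hsub'
    with h | h
  · exfalso
    -- an inner point `p` of the common crosscut, inside `D'`, with a ball `B(p, r) ⊆ D'`
    obtain ⟨p, hpL, hpD'⟩ := exists_mem_crosscut_mem_carrier hL'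
    obtain ⟨r, hr, hball⟩ := Metric.isOpen_iff.1 D'.isOpen p hpD'
    -- `W` accumulates at `p ∈ L ⊆ frontier W`
    have hpW : p ∈ closure (otherComponent hL hqb) := by
      refine frontier_subset_closure ?_
      rw [frontier_otherComponent]
      exact Or.inl (hLL' ▸ hpL)
    obtain ⟨y, hyW, hyd⟩ := Metric.mem_closure_iff.1 hpW r hr
    have hyD' : y ∈ D'.carrier := hball (mem_ball.2 (by rw [dist_comm]; exact hyd))
    have hyL : y ∉ L := (otherComponent_subset hL hqb hyW).2
    have hy : y ∈ bComponent hL' hqb' ∪ otherComponent hL' hqb' := by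
      rw [union_components, hLL']
      exact ⟨hyD', hyL⟩
    have hyE : y ∈ bComponent hL hqb := by
      rcases hy with hy | hy
      · exact bComponent_subset_bComponent hL hqb hL' hqb' hsub h1 hLL' hy
      · exact h hy
    exact Set.disjoint_left.1 (disjoint_components hL hqb) hyE hyW
  · exact h

/-- Points of the big `b`-component inside `D'` are in the small `b`-component. [folklore] -/
theorem bComponent_inter_subset (hsub : D'.carrier ⊆ D.carrier) (h1 : D'.pt 1 = D.pt 1)
    (hLL' : L' = L) : bComponent hL hqb ∩ D'.carrier ⊆ bComponent hL' hqb' := by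
  rintro x ⟨hxE, hxD'⟩
  have hxL : x ∉ L := (bComponent_subset hL hqb hxE).2
  have hx : x ∈ bComponent hL' hqb' ∪ otherComponent hL' hqb' := by
    rw [union_components, hLL']
    exact ⟨hxD', hxL⟩
  rcases hx with hx | hx
  · exact hx
  · exact absurd (otherComponent_subset_otherComponent hL hqb hL' hqb' hsub h1 hLL' hx)
      (Set.disjoint_left.1 (disjoint_components hL hqb) hxE)

/-- **`E ∖ E' ⊆ D ∖ D'`.** [folklore] -/
theorem bComponent_diff_subset (hsub : D'.carrier ⊆ D.carrier) (h1 : D'.pt 1 = D.pt 1)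
    (hLL' : L' = L) : bComponent hL hqb \ bComponent hL' hqb' ⊆ D.carrier \ D'.carrier := by
  rintro x ⟨hxE, hxE'⟩
  exact ⟨(bComponent_subset hL hqb hxE).1, fun hxD' =>
    hxE' (bComponent_inter_subset hL hqb hL' hqb' hsub h1 hLL' ⟨hxE, hxD'⟩)⟩

/-- **The stopping set seen from the `b`-component.** If the points of `L` inside `D` lie in `D'`,
then `closure (D ∖ D') ∩ closure E ⊆ closure (E ∖ E') ∪ L`. [folklore] -/
theorem closure_diff_inter_closure_subset (hLD : L ∩ D.carrier ⊆ D'.carrier) :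
    closure (D.carrier \ D'.carrier) ∩ closure (bComponent hL hqb) ⊆
      closure (bComponent hL hqb \ bComponent hL' hqb') ∪ L := by
  have hdiff : D.carrier \ D'.carrier ⊆
      (bComponent hL hqb \ bComponent hL' hqb') ∪ otherComponent hL hqb := by
    rintro x ⟨hxD, hxD'⟩
    have hxL : x ∉ L := fun hxL => hxD' (hLD ⟨hxL, hxD⟩)
    have hx : x ∈ bComponent hL hqb ∪ otherComponent hL hqb := by
      rw [union_components]
      exact ⟨hxD, hxL⟩
    rcases hx with hx | hx
    · exact Or.inl ⟨hx, fun hxE' => hxD' (bComponent_subset hL' hqb' hxE').1⟩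
    · exact Or.inr hx
  rintro x ⟨hxF, hxE⟩
  have hx := closure_mono hdiff hxF
  rw [closure_union] at hx
  rcases hx with hx | hx
  · exact Or.inl hx
  · exact Or.inr (closure_bComponent_inter_closure_otherComponent hL hqb ⟨hxE, hx⟩)

end TwoDomains

end FatSurgeryLocal

open FatSurgeryLocal in
/-- **Nested crosscut domains with a common crosscut** (helper sub-goal of `stub_fatSurgeryLocal`):
for Dobrushin domains `D' ⊆ D` with the same target and a common crosscut `L` (landing off the
target) whose points inside `D` lie in `D'`, the `b`-components `E' ⊆ E` are nested,
`E ∖ E' ⊆ D ∖ D'`, and `closure (D ∖ D') ∩ closure E ⊆ closure (E ∖ E') ∪ L`. [folklore] -/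
theorem stub_fatSurgeryLocalGeom : ∀ (D D' : DobrushinDomain) (L L' : Set ℂ) (q q' : ℂ) (hL : D.IsCrosscut L (D.pt 0) q) (hqb : q ≠ D.pt 1) (hL' : D'.IsCrosscut L' (D'.pt 0) q') (hqb' : q' ≠ D'.pt 1), D'.carrier ⊆ D.carrier → D'.pt 1 = D.pt 1 → L' = L → L ∩ D.carrier ⊆ D'.carrier → Summit.CriticalPhenomena.CardyFormulaZ2.Theorems.CardyRotToConfR2SymmetryUpgrade.Negative.bComponent hL' hqb' ⊆ Summit.CriticalPhenomena.CardyFormulaZ2.Theorems.CardyRotToConfR2SymmetryUpgrade.Negative.bComponent hL hqb ∧ Summit.CriticalPhenomena.CardyFormulaZ2.Theorems.CardyRotToConfR2SymmetryUpgrade.Negative.bComponent hL hqb \ Summit.CriticalPhenomena.CardyFormulaZ2.Theorems.CardyRotToConfR2SymmetryUpgrade.Negative.bComponent hL' hqb' ⊆ D.carrier \ D'.carrier ∧ closure (D.carrier \ D'.carrier) ∩ closure (Summit.CriticalPhenomena.CardyFormulaZ2.Theorems.CardyRotToConfR2SymmetryUpgrade.Negative.bComponent hL hqb) ⊆ closure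 (Summit.CriticalPhenomena.CardyFormulaZ2.Theorems.CardyRotToConfR2SymmetryUpgrade.Negative.bComponent hL hqb \ Summit.CriticalPhenomena.CardyFormulaZ2.Theorems.CardyRotToConfR2SymmetryUpgrade.Negative.bComponent hL' hqb') ∪ L :=
  fun _ _ _ _ _ _ hL hqb hL' hqb' hsub h1 hLL' hLD =>
    ⟨bComponent_subset_bComponent hL hqb hL' hqb' hsub h1 hLL',
      bComponent_diff_subset hL hqb hL' hqb' hsub h1 hLL',
      closure_diff_inter_closure_subset hL hqb hL' hqb' hLD⟩

end Summit.CriticalPhenomena.CardyFormulaZ2.Theorems.CardyRotToConfR2SymmetryUpgrade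

end
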